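import Mathlib.Geometry.Manifold.Complex
import Mathlib.Geometry.Manifold.MFDeriv.Basic
import Mathlib.Geometry.Manifold.MFDeriv.SpecificFunctions
import Mathlib.Geometry.Manifold.Riemannian.Basic
import Mathlib.Geometry.Manifold.VectorBundle.Riemannian
import Mathlib.Analysis.SpecialFunctions.Log.Basic
import Mathlib.Analysis.InnerProductSpace.Basic
import HarnessLib

/-!
# Poincaré-type metrics on the complement of a smooth hypersurface

Notion `PoincareTypeMetric` (definition request `defn-PoincareTypeMetric` of route
`HodgeConjecture/AffinePartDecay`: items `FiniteEnergyRepresentative`, `L2Prolongation`,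
`PoincareHeatFlow` quantify over "a Poincaré-type metric `ω_P` on `M ∖ D`").

Setting: `M` a complex manifold modelled on the complex normed space `E` (as in
`Literature.Geometry.Kaehler.Kaehler`: `[IsManifold 𝓘(ℂ, E) ω M] [IsManifold 𝓘(ℝ, E) ∞ M]`, same
charts), `U : Opens M` with its open-submanifold charts (`TopologicalSpace.Opens.instChartedSpace`),
`D := (↑U)ᶜ` its closed complement (in the applications a smooth complex hypersurface, `U = M ∖ D`),
`g : Bundle.RiemannianMetric (fun x : U ↦ TangentSpace 𝓘(ℝ, E) x)` a metric on the real tangent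
bundle of `U`.

The **Poincaré metric** of the punctured disc `Δ*` is `|dz|²/(|z|² log²|z|²)` (quotient of the
upper half plane; Carlson–Müller-Stach–Peters (2017), §13.6 (iii)). A metric on `M ∖ D` is **of
Poincaré type along `D`** if every `p ∈ D` has a holomorphic chart `φ` of `M` with `D = {z₁ = 0}`
in which `g` is **quasi-isometric** (mutually bounded, `C⁻¹·model ≤ g ≤ C·model`) near `p` to the
local model `|dz₁|²/(|z₁|² log²|z₁|) + Σ_{j≥2}|dz_j|²` — Zucker (1979), §3 ("asymptotic to the
Poincaré metric", curves); Biquard (1997), §2.C, (2.3)–(2.5), p. 48 (smooth divisor: the metric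
`T·ω₀ − i∂∂̄ log log²|σ|²` "est donc complète, à volume fini, elle est asymptotique au produit
du disque de Poincaré `D*`, avec sa métrique `|dz⁰|²/(|z⁰|² Log²|z⁰|²)`, et du diviseur");
Mochizuki (2006), §5.2 ("the Poincaré metric `Σᵢ dζᵢ·dζ̄ᵢ/(|ζᵢ|²(−log|ζᵢ|²)²)`", "Poincaré
like metric `ω + C₁ ∂∂̄ log(−log|σ|²)`"); Cornalba–Griffiths (1975).

## Main definitions

* `Literature.Geometry.Kaehler.poincareModelQuad ℓ z v = ‖ℓ v‖²/(‖ℓ z‖²·log²‖ℓ z‖) + ‖v‖²`: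
  the local model on the model space; the functional `ℓ : E →L[ℂ] ℂ` is the coordinate `z₁`.
* `Literature.Geometry.Kaehler.IsPoincareTypeAt g p`: the local condition at `p ∈ D` — an
  adapted chart `φ` of the maximal holomorphic atlas, `ℓ ≠ 0` with
  `U ∩ φ.source = {x ∈ φ.source | ℓ (φ x) ≠ 0}`, `C > 0`, and for `x ∈ U` near `p`:
  `‖ℓ (φ x)‖ < 1` and `C⁻¹·q ≤ g_x(v,v) ≤ C·q` for all tangent vectors `v`, with
  `q = poincareModelQuad ℓ (φ x) (mfderiv 𝓘(ℂ, E) 𝓘(ℂ, E) φ x v)` (coordinates of `v` in `φ`).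
* `Literature.Geometry.Kaehler.IsPoincareType g`: `IsPoincareTypeAt g p` for every `p ∈ (↑U)ᶜ` —
  the predicate the route items quantify over, next to `g.IsKaehler` and smoothness.
* API: `poincareModelQuad_nonneg/_smul` (Hermitian), `norm_sq_le_poincareModelQuad`;
  `IsPoincareTypeAt.exists_adaptedChart`, `IsPoincareTypeAt.mem_closure` (such `p` are limit
  points of `U`: never a condition on the empty set; `IsPoincareType g` fails when `D` has
  interior); `IsPoincareTypeAt.of_bounds`, `IsPoincareType.of_bounds` (only the quasi-isometry
  class matters); `isPoincareType_of_coe_eq_univ` (`D = ∅`); sanity model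
  `PoincarePuncturedPlane.isPoincareType_metric` (`ℂ ∖ {0}`, `φ = ℓ = id`, `C = 2` on
  `|z| < e⁻¹`).

## Design notes

* *Quasi-isometry class only.* Constant factors are immaterial (`log²|z|² = 4 log²|z|`; Kähler
  form vs. metric), and so is the transverse part: `1/(|z₁|² log²|z₁|) → +∞` at `z₁ = 0`, so
  `|dz₁|²/(|z₁|² log²|z₁|) + Σ_{j≥2}|dz_j|²` and `|dz₁|²/(|z₁|² log²|z₁|) + Σ_{j≥1}|dz_j|²` are
  mutually bounded on `0 < |z₁| < e⁻¹`, and on finite-dimensional `E` all norms are equivalent;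
  hence `poincareModelQuad` uses the norm of `E` as transverse part and needs no basis. The clause
  `‖ℓ (φ x)‖ < 1` keeps `log ‖ℓ (φ x)‖ ≠ 0`: no junk value of `/` is consulted on `U` (where also
  `ℓ (φ x) ≠ 0`).
* *Charts.* `φ` ranges over `IsManifold.maximalAtlas 𝓘(ℂ, E) ω M` (adapted charts are rarely in
  the given atlas); the normalisation `D ∩ φ.source = {ℓ ∘ φ = 0}`, `ℓ` linear, loses no
  generality (translations and linear automorphisms preserve the maximal atlas). Tangent vectors
  of `U` at `x` and of `M` at `↑x` are both `E` definitionally; their expression in the chart `φ`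
  is `mfderiv 𝓘(ℂ, E) 𝓘(ℂ, E) φ x v`.
* *Local and fibrewise.* `Bundle.RiemannianMetric` carries no continuity in the base point;
  smoothness, the Kähler condition, completeness and finite volume are separate hypotheses or
  consequences, not part of the predicate, which is local along `D` (as requested; uniform near
  `D` when `D` is compact and `g` continuous). Auvray (2017), Def. 1.1 is a stronger *global
  `C^∞`* notion (bounds on all of `M ∖ D`, bounded derivatives of all orders, fixed cohomology
  class) — deliberately not the one formalised. Only the smooth-hypersurface model is covered, as
  requested; the normal-crossings model `Σ_{i≤k}|dzᵢ|²/(|zᵢ|² log²|zᵢ|) + Σ_{j>k}|dz_j|²`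
  (Mochizuki (2006), §5.2; Auvray (2017), Prop. 1.2) would take a finite family of functionals.
* *Not here.* Existence and properties of the standard metric `T·ω₀ − i∂∂̄ log log²‖σ‖⁻²` on
  `M ∖ D` for compact Kähler `M` (Kähler, complete, finite volume, Poincaré type: Zucker (1979),
  §3; Biquard (1997), §2.C; Auvray (2017), §1.1) involve Riemannian distance/volume of
  `Bundle.RiemannianMetric`s, absent from Mathlib v4.32.0; not vendored here (facts on request).
* *Mathlib status.* No Poincaré metric, quasi-isometry of metrics, or metrics with prescribed
  asymptotics along a divisor in Mathlib (v4.32.0); nothing here duplicates a Mathlib declaration.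

## References

* S. Zucker, *Hodge theory with degenerating coefficients: `L₂` cohomology in the Poincaré
  metric*, Ann. of Math. 109 (1979), 415–476, §3 (key `Zucker1979`).
* M. Cornalba, P. Griffiths, *Analytic cycles and vector bundles on non-compact algebraic
  varieties*, Invent. Math. 28 (1975), 1–106 (key `CornalbaGriffiths1975`).
* O. Biquard, *Fibrés de Higgs et connexions intégrables : le cas logarithmique (diviseur lisse)*,
  Ann. Sci. ÉNS (4) 30 (1997), 41–96, §2.C, (2.3)–(2.5), p. 48 (key `Biquard1997`).
* T. Mochizuki, *Kobayashi–Hitchin correspondence for tame harmonic bundles and an application*,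
  Astérisque 309 (2006), arXiv:math/0411300, §5.2; §2.6 of Ch. "Around a smooth point of the
  divisor" (key `Mochizuki2006KHI`).
* H. Auvray, *The space of Poincaré type Kähler metrics on the complement of a divisor*, J. reine
  angew. Math. 722 (2017), 1–64, §1.1–1.2, Def. 1.1, Prop. 1.2 (key `Auvray2017`).
* J. Carlson, S. Müller-Stach, C. Peters, *Period Mappings and Period Domains*, 2nd ed. (2017),
  §13.6 (iii) (key `CarlsonMullerStachPeters2017`).
-/

noncomputable section

open scoped Manifold ContDiff Topology
open Bundle Set Filter TopologicalSpace

namespace Literature.Geometry.Kaehler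

/-! ### The local model on the model vector space -/

section Model

variable {E : Type*} [NormedAddCommGroup E] [NormedSpace ℂ E]

/-- The **local Poincaré model** as a quadratic form on the model space `E`:
`poincareModelQuad ℓ z v = ‖ℓ v‖² / (‖ℓ z‖² · (log ‖ℓ z‖)²) + ‖v‖²`, the metric
`|dz₁|²/(|z₁|² log²|z₁|) + ‖dz‖²` at the point `z` evaluated on the vector `v`, the continuous
`ℂ`-linear functional `ℓ : E →L[ℂ] ℂ` playing the role of the coordinate `z₁` (Poincaré metric of
the punctured disc in the `z₁`-direction — Carlson–Müller-Stach–Peters (2017), §13.6 (iii);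
Biquard (1997), (2.4); Mochizuki (2006), §5.2 — plus the norm of `E` as transverse part, which is
the printed `Σ_{j≥2}|dz_j|²` up to mutual bounds near `z₁ = 0`, see the module docstring).
Meaningful for `0 < ‖ℓ z‖ < 1`; at `ℓ z = 0` or `‖ℓ z‖ = 1` the first summand is the junk value
`0` of `/`, never consulted by `IsPoincareTypeAt`. [cite: Biquard1997, §2.C (2.4)–(2.5), p. 48] -/
def poincareModelQuad (ℓ : E →L[ℂ] ℂ) (z v : E) : ℝ :=
  ‖ℓ v‖ ^ 2 / (‖ℓ z‖ ^ 2 * Real.log ‖ℓ z‖ ^ 2) + ‖v‖ ^ 2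

/-- Unfolding of `poincareModelQuad`. [folklore] -/
theorem poincareModelQuad_def (ℓ : E →L[ℂ] ℂ) (z v : E) :
    poincareModelQuad ℓ z v = ‖ℓ v‖ ^ 2 / (‖ℓ z‖ ^ 2 * Real.log ‖ℓ z‖ ^ 2) + ‖v‖ ^ 2 :=
  rfl

/-- The local Poincaré model is a nonnegative quadratic form. [folklore] -/
theorem poincareModelQuad_nonneg (ℓ : E →L[ℂ] ℂ) (z v : E) : 0 ≤ poincareModelQuad ℓ z v := by
  unfold poincareModelQuad
  positivity

/-- The local Poincaré model is Hermitian: `q(c • v) = ‖c‖² · q(v)` for `c : ℂ`; in particular it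
is invariant under the complex structure `v ↦ i • v`. [folklore] -/
theorem poincareModelQuad_smul (ℓ : E →L[ℂ] ℂ) (z v : E) (c : ℂ) :
    poincareModelQuad ℓ z (c • v) = ‖c‖ ^ 2 * poincareModelQuad ℓ z v := by
  unfold poincareModelQuad
  rw [map_smul, smul_eq_mul, norm_mul, norm_smul, mul_pow, mul_pow, mul_add, mul_div_assoc]

/-- The local Poincaré model dominates the squared norm (its transverse part). [folklore] -/
theorem norm_sq_le_poincareModelQuad (ℓ : E →L[ℂ] ℂ) (z v : E) :
    ‖v‖ ^ 2 ≤ poincareModelQuad ℓ z v := by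
  unfold poincareModelQuad
  have : 0 ≤ ‖ℓ v‖ ^ 2 / (‖ℓ z‖ ^ 2 * Real.log ‖ℓ z‖ ^ 2) := by positivity
  linarith

end Model

/-! ### Poincaré-type metrics on `U = M ∖ D` -/

section Manifold

/- No `IsManifold` hypothesis is needed to *state* the predicates (`Bundle.RiemannianMetric` is
fibrewise data; `IsManifold.maximalAtlas`, `mfderiv` exist on any charted space); they are meant
for complex manifolds `[IsManifold 𝓘(ℂ, E) ω M]`, real manifolds `[IsManifold 𝓘(ℝ, E) ∞ M]`. -/
variable {E : Type*} [NormedAddCommGroup E] [NormedSpace ℂ E]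
  {M : Type*} [TopologicalSpace M] [ChartedSpace E M] {U : Opens M}

/-- **Poincaré growth of a metric at a boundary point.** For `U : Opens M` in the complex
manifold `M`, a Riemannian metric `g` on the real tangent bundle of `U` and `p : M` (of interest
for `p ∈ D := (↑U)ᶜ`): there are a chart `φ` in the maximal holomorphic atlas of `M` at `p`, a
functional `ℓ ≠ 0` with `U ∩ φ.source = {x ∈ φ.source | ℓ (φ x) ≠ 0}` (near `p`, `D` is the
smooth hypersurface `{ℓ ∘ φ = 0}`, "`D = {z₁ = 0}`") and `C > 0` such that for all `x ∈ U` near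
`p`: `‖ℓ (φ x)‖ < 1` and, for every tangent vector `v` at `x` with coordinate expression
`w = mfderiv 𝓘(ℂ, E) 𝓘(ℂ, E) φ x v` in the chart, `C⁻¹·q ≤ g_x(v, v) ≤ C·q`,
`q = poincareModelQuad ℓ (φ x) w = |dz₁(w)|²/(|z₁|² log²|z₁|) + ‖w‖²`, `z₁ = ℓ (φ x)`: `g` is
quasi-isometric near `p` to (Poincaré punctured disc) × (Euclidean). Zucker (1979), §3;
Biquard (1997), §2.C (2.4)–(2.5), p. 48; Mochizuki (2006), §5.2. A predicate on metrics (explicit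
`g`, `p`), not a named fact. [cite: Biquard1997, §2.C (2.3)–(2.5), p. 48] -/
def IsPoincareTypeAt (g : RiemannianMetric (fun x : U ↦ TangentSpace 𝓘(ℝ, E) x)) (p : M) :
    Prop :=
  ∃ φ ∈ IsManifold.maximalAtlas 𝓘(ℂ, E) ω M, p ∈ φ.source ∧
    ∃ ℓ : E →L[ℂ] ℂ, ℓ ≠ 0 ∧ (∀ x ∈ φ.source, x ∈ (U : Set M) ↔ ℓ (φ x) ≠ 0) ∧
      ∃ C : ℝ, 0 < C ∧ ∀ᶠ x in 𝓝 p, ∀ hx : x ∈ (U : Set M), ‖ℓ (φ x)‖ < 1 ∧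
        ∀ v : TangentSpace 𝓘(ℝ, E) (⟨x, hx⟩ : U),
          C⁻¹ * poincareModelQuad ℓ (φ x) (mfderiv 𝓘(ℂ, E) 𝓘(ℂ, E) φ x v) ≤
              g.inner ⟨x, hx⟩ v v ∧
            g.inner ⟨x, hx⟩ v v ≤
              C * poincareModelQuad ℓ (φ x) (mfderiv 𝓘(ℂ, E) 𝓘(ℂ, E) φ x v)

/-- **Poincaré-type metric.** A Riemannian metric `g` on (the real tangent bundle of) the open
subset `U` of the complex manifold `M` is *of Poincaré type along `D = (↑U)ᶜ`* if it has
Poincaré growth (`IsPoincareTypeAt`) at every point of `D`: near each `p ∈ D`, in a holomorphic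
chart with `D = {z₁ = 0}`, `g` is quasi-isometric to `|dz₁|²/(|z₁|² log²|z₁|) + Σ_j |dz_j|²`.
This forces `D` to be a smooth complex hypersurface (`IsPoincareTypeAt.exists_adaptedChart`,
`.mem_closure`); the Kähler condition (`Bundle.RiemannianMetric.IsKaehler`), smoothness,
completeness and finite volume are *not* part of the predicate. Zucker (1979), §3 ("asymptotic
to the Poincaré metric"); Cornalba–Griffiths (1975); Biquard (1997), §2.C (smooth divisor, this
model); Mochizuki (2006), §5.2; cf. the stronger global `C^∞` notion of Auvray (2017), Def. 1.1.
A predicate (inhabited by `PoincarePuncturedPlane.metric`, false when `D` has interior), not a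
named fact. [cite: Zucker1979, §3] -/
def IsPoincareType (g : RiemannianMetric (fun x : U ↦ TangentSpace 𝓘(ℝ, E) x)) : Prop :=
  ∀ p ∈ (U : Set M)ᶜ, IsPoincareTypeAt g p

/-- At a point where `g` has Poincaré growth, `D = (↑U)ᶜ` is cut out in a chart of the maximal
holomorphic atlas by a nonzero linear functional, `D ∩ φ.source = {ℓ ∘ φ = 0}`: `D` is a smooth
complex hypersurface there (Biquard (1997), §2: "diviseur lisse"). [folklore] -/
theorem IsPoincareTypeAt.exists_adaptedChart
    {g : RiemannianMetric (fun x : U ↦ TangentSpace 𝓘(ℝ, E) x)} {p : M}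
    (h : IsPoincareTypeAt g p) :
    ∃ φ ∈ IsManifold.maximalAtlas 𝓘(ℂ, E) ω M, p ∈ φ.source ∧
      ∃ ℓ : E →L[ℂ] ℂ, ℓ ≠ 0 ∧ ∀ x ∈ φ.source, x ∈ (U : Set M) ↔ ℓ (φ x) ≠ 0 := by
  obtain ⟨φ, hφ, hp, ℓ, hℓ, hD, -⟩ := h
  exact ⟨φ, hφ, hp, ℓ, hℓ, hD⟩

/-- A point at which `g` has Poincaré growth is a limit point of `U`: the two-sided bound in
`IsPoincareTypeAt` is never a condition on the empty set. (In the adapted chart, `φ p + t • e`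
with `ℓ e ≠ 0` lies in `U` for all small `t ≠ 0` when `p ∉ U`.) Consequently `IsPoincareType g`
fails as soon as `D = (↑U)ᶜ` has an interior point. [folklore] -/
theorem IsPoincareTypeAt.mem_closure
    {g : RiemannianMetric (fun x : U ↦ TangentSpace 𝓘(ℝ, E) x)} {p : M}
    (h : IsPoincareTypeAt g p) : p ∈ closure (U : Set M) := by
  obtain ⟨φ, -, hp, ℓ, hℓ, hD, -⟩ := h
  by_cases hpU : p ∈ (U : Set M)
  · exact subset_closure hpU
  -- `ℓ (φ p) = 0`, and `ℓ e ≠ 0` for some `e`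
  have hp0 : ℓ (φ p) = 0 := by
    by_contra hne
    exact hpU ((hD p hp).2 hne)
  obtain ⟨e, he⟩ : ∃ e : E, ℓ e ≠ 0 := not_forall.1 fun hall ↦ hℓ (ContinuousLinearMap.ext hall)
  rw [mem_closure_iff_nhds]
  intro s hs
  -- the curve `t ↦ φ.symm (φ p + t • e)` tends to `p` as `t → 0` and lies in `U` for `t ≠ 0`
  have h1 : Tendsto (fun t : ℝ ↦ φ p + (t : ℂ) • e) (𝓝 0) (𝓝 (φ p)) := by
    have : Continuous (fun t : ℝ ↦ φ p + (t : ℂ) • e) := by fun_prop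
    simpa using this.tendsto 0
  have hcont : Tendsto (fun t : ℝ ↦ φ.symm (φ p + (t : ℂ) • e)) (𝓝 0) (𝓝 p) := by
    have h3 := (φ.continuousAt_symm (φ.map_source hp)).tendsto.comp h1
    rwa [Function.comp_def, φ.left_inv hp] at h3
  have htarget : ∀ᶠ t : ℝ in 𝓝 0, φ p + (t : ℂ) • e ∈ φ.target :=
    h1 (φ.open_target.mem_nhds (φ.map_source hp))
  have hs' : ∀ᶠ t : ℝ in 𝓝 0, φ.symm (φ p + (t : ℂ) • e) ∈ s := hcont hs
  obtain ⟨ε, hε, hball⟩ := Metric.eventually_nhds_iff.1 (hs'.and htarget)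
  have ht : dist (ε / 2) (0 : ℝ) < ε := by
    rw [dist_zero_right, Real.norm_of_nonneg (half_pos hε).le]
    exact half_lt_self hε
  obtain ⟨hts, htt⟩ := hball ht
  refine ⟨φ.symm (φ p + ((ε / 2 : ℝ) : ℂ) • e), hts, (hD _ (φ.map_target htt)).2 ?_⟩
  rw [φ.right_inv htt, map_add, hp0, zero_add, map_smul, smul_eq_mul]
  exact mul_ne_zero (Complex.ofReal_ne_zero.2 (half_pos hε).ne') he

/-- **Quasi-isometry invariance (local).** If `g` has Poincaré growth at `p` and `g'` is mutually
bounded with `g` (`c⁻¹ g ≤ g' ≤ c g` on `U`), then `g'` has Poincaré growth at `p`, with the same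
adapted chart and constant `C · c`: the notion only depends on the quasi-isometry class of the
metric (Zucker (1979), §3; Auvray (2017), Def. 1.1 (1)). [folklore] -/
theorem IsPoincareTypeAt.of_bounds
    {g g' : RiemannianMetric (fun x : U ↦ TangentSpace 𝓘(ℝ, E) x)} {p : M}
    (h : IsPoincareTypeAt g p) {c : ℝ} (hc : 0 < c)
    (hle : ∀ (x : U) (v : TangentSpace 𝓘(ℝ, E) x), c⁻¹ * g.inner x v v ≤ g'.inner x v v)
    (hge : ∀ (x : U) (v : TangentSpace 𝓘(ℝ, E) x), g'.inner x v v ≤ c * g.inner x v v) :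
    IsPoincareTypeAt g' p := by
  obtain ⟨φ, hφ, hp, ℓ, hℓ, hD, C, hC, hev⟩ := h
  refine ⟨φ, hφ, hp, ℓ, hℓ, hD, C * c, mul_pos hC hc, ?_⟩
  filter_upwards [hev] with x hx hxU
  obtain ⟨h1, h2⟩ := hx hxU
  refine ⟨h1, fun v ↦ ?_⟩
  obtain ⟨hlow, hupp⟩ := h2 v
  set q := poincareModelQuad ℓ (φ x) (mfderiv 𝓘(ℂ, E) 𝓘(ℂ, E) φ x v)
  constructor
  · calc (C * c)⁻¹ * q = c⁻¹ * (C⁻¹ * q) := by rw [mul_inv, mul_comm C⁻¹, mul_assoc]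
      _ ≤ c⁻¹ * g.inner ⟨x, hxU⟩ v v := mul_le_mul_of_nonneg_left hlow (inv_nonneg.2 hc.le)
      _ ≤ g'.inner ⟨x, hxU⟩ v v := hle _ v
  · calc g'.inner ⟨x, hxU⟩ v v ≤ c * g.inner ⟨x, hxU⟩ v v := hge _ v
      _ ≤ c * (C * q) := mul_le_mul_of_nonneg_left hupp hc.le
      _ = C * c * q := by ring

/-- **Quasi-isometry invariance.** A metric mutually bounded with a Poincaré-type metric is of
Poincaré type (Zucker (1979), §3; Auvray (2017), Def. 1.1 (1)). [folklore] -/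
theorem IsPoincareType.of_bounds
    {g g' : RiemannianMetric (fun x : U ↦ TangentSpace 𝓘(ℝ, E) x)} (h : IsPoincareType g)
    {c : ℝ} (hc : 0 < c)
    (hle : ∀ (x : U) (v : TangentSpace 𝓘(ℝ, E) x), c⁻¹ * g.inner x v v ≤ g'.inner x v v)
    (hge : ∀ (x : U) (v : TangentSpace 𝓘(ℝ, E) x), g'.inner x v v ≤ c * g.inner x v v) :
    IsPoincareType g' :=
  fun p hp ↦ (h p hp).of_bounds hc hle hge

/-- Degenerate case `D = ∅` (`U = ⊤`): every metric on `M` is of Poincaré type along the empty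
hypersurface — the condition quantifies over the points of `D`. [folklore] -/
theorem isPoincareType_of_coe_eq_univ (hU : (U : Set M) = univ)
    (g : RiemannianMetric (fun x : U ↦ TangentSpace 𝓘(ℝ, E) x)) : IsPoincareType g := by
  intro p hp
  rw [hU, compl_univ] at hp
  exact hp.elim

end Manifold

/-! ### Sanity model: the (regularised) Poincaré metric of the punctured plane

`ℂ ∖ {0}` with the conformal metric `(1 + 1/(|z|² (1 + log²|z|))) |dz|²`, near `0` mutually
bounded with the Poincaré metric `|dz|²/(|z|² log²|z|)` of `Δ*` (Carlson–Müller-Stach–Peters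
(2017), §13.6 (iii)) plus `|dz|²`: `IsPoincareType` is inhabited at an actual boundary point. -/

namespace PoincarePuncturedPlane

/-- Elementary two-sided bound behind `isPoincareType_metric`: for `a > 0`, `L² ≥ 1`, `t ≥ 0`,
`½ (t/(a L²) + t) ≤ (1 + 1/(a (1 + L²))) t ≤ 2 (t/(a L²) + t)`. [folklore] -/
theorem two_sided_bound (a L t : ℝ) (ha : 0 < a) (hL : 1 ≤ L ^ 2) (ht : 0 ≤ t) :
    2⁻¹ * (t / (a * L ^ 2) + t) ≤ (1 + (a * (1 + L ^ 2))⁻¹) * t ∧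
      (1 + (a * (1 + L ^ 2))⁻¹) * t ≤ 2 * (t / (a * L ^ 2) + t) := by
  have hL2 : 0 < L ^ 2 := lt_of_lt_of_le one_pos hL
  have hD1 : 0 < a * L ^ 2 := mul_pos ha hL2
  have hD2 : 0 < a * (1 + L ^ 2) := by positivity
  have hle : a * L ^ 2 ≤ a * (1 + L ^ 2) := by nlinarith
  have hle2 : a * (1 + L ^ 2) ≤ 2 * (a * L ^ 2) := by nlinarith
  have key1 : (a * (1 + L ^ 2))⁻¹ * t ≤ t / (a * L ^ 2) := by
    rw [inv_mul_eq_div]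
    exact div_le_div_of_nonneg_left ht hD1 hle
  have key2 : t / (a * L ^ 2) ≤ 2 * ((a * (1 + L ^ 2))⁻¹ * t) := by
    rw [inv_mul_eq_div, ← mul_div_assoc, ← mul_div_mul_left t (a * L ^ 2) two_ne_zero]
    exact div_le_div_of_nonneg_left (by positivity) hD2 hle2
  have hexp : (1 + (a * (1 + L ^ 2))⁻¹) * t = t + (a * (1 + L ^ 2))⁻¹ * t := by ring
  constructor <;> linarith

/-- The conformal factor `ρ(z) = 1 + 1/(|z|² (1 + log²|z|)) ≥ 1` (near `z = 0` comparable to the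
Poincaré factor `1/(|z|² log²|z|)`). [folklore] -/
def confFactor (z : ℂ) : ℝ := 1 + (‖z‖ ^ 2 * (1 + Real.log ‖z‖ ^ 2))⁻¹

/-- `ρ ≥ 1`. [folklore] -/
theorem one_le_confFactor (z : ℂ) : 1 ≤ confFactor z := by
  unfold confFactor
  have : 0 ≤ (‖z‖ ^ 2 * (1 + Real.log ‖z‖ ^ 2))⁻¹ := by positivity
  linarith

/-- The punctured plane `ℂ ∖ {0}` as an open subset of the complex manifold `ℂ`. [folklore] -/
def puncturedPlane : Opens ℂ := ⟨{0}ᶜ, isOpen_compl_singleton⟩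

/-- The regularised Poincaré metric `g_z(v, w) = ρ(z) · Re (v w̄)` on the real tangent bundle of
the punctured plane (fibrewise inner products inducing the topology). Carlson–Müller-Stach–Peters
(2017), §13.6 (iii) (Poincaré metric of `Δ*`). [folklore] -/
def metric : RiemannianMetric (fun x : puncturedPlane ↦ TangentSpace 𝓘(ℝ, ℂ) x) where
  inner x := confFactor (x : ℂ) • (innerSL ℝ : ℂ →L[ℝ] ℂ →L[ℝ] ℝ)
  symm x v w := by
    change confFactor (x : ℂ) * @inner ℝ ℂ _ v w = confFactor (x : ℂ) * @inner ℝ ℂ _ w v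
    rw [real_inner_comm]
  pos x v hv := by
    change 0 < confFactor (x : ℂ) * @inner ℝ ℂ _ v v
    rw [real_inner_self_eq_norm_sq]
    have h1 := one_le_confFactor (x : ℂ)
    have h2 : 0 < @norm ℂ _ v := norm_pos_iff.2 hv
    positivity
  continuousAt x := by
    let B : ℂ →L[ℝ] ℂ →L[ℝ] ℝ := confFactor (x : ℂ) • (innerSL ℝ : ℂ →L[ℝ] ℂ →L[ℝ] ℝ)
    change ContinuousAt (fun v : ℂ ↦ B v v) 0
    exact (B.continuous₂.comp (continuous_id.prodMk continuous_id)).continuousAt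
  isVonNBounded x := by
    change Bornology.IsVonNBounded ℝ {v : ℂ | confFactor (x : ℂ) * inner ℝ v v < 1}
    refine (NormedSpace.isVonNBounded_ball ℝ ℂ 1).subset ?_
    intro v hv
    rw [Set.mem_setOf_eq, real_inner_self_eq_norm_sq] at hv
    rw [Metric.mem_ball, dist_zero_right]
    have h1 := one_le_confFactor (x : ℂ)
    nlinarith [norm_nonneg v, mul_le_mul_of_nonneg_right h1 (sq_nonneg ‖v‖)]

/-- The metric of the sanity model is `g_z(v, v) = ρ(z) ‖v‖²`. [folklore] -/
theorem metric_inner_self (x : puncturedPlane) (v : ℂ) :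
    metric.inner x v v = confFactor (x : ℂ) * ‖v‖ ^ 2 := by
  change confFactor (x : ℂ) * inner ℝ v v = _
  rw [real_inner_self_eq_norm_sq]

/-- **Sanity check.** The regularised Poincaré metric of the punctured plane is of Poincaré type
along `{0}`: at `0` take the identity chart `φ = id` (in the maximal holomorphic atlas of `ℂ`),
`ℓ = id` (`{0} = {ℓ = 0}`), `C = 2` and the neighbourhood `|z| < e⁻¹` (`log²|z| ≥ 1`); then
`½ q ≤ ρ(z)|v|² ≤ 2 q` for `q = |v|²/(|z|² log²|z|) + |v|²` (`two_sided_bound`).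
Carlson–Müller-Stach–Peters (2017), §13.6 (iii); Zucker (1979), §3. [folklore] -/
theorem isPoincareType_metric : IsPoincareType metric := by
  intro p hp
  have hp0 : p = 0 := by simpa [puncturedPlane] using hp
  subst hp0
  refine ⟨OpenPartialHomeomorph.refl ℂ, ?_, ?_, ContinuousLinearMap.id ℂ ℂ, ?_, ?_, 2, two_pos,
    ?_⟩
  · exact IsManifold.chart_mem_maximalAtlas (H := ℂ) (0 : ℂ)
  · simp
  · exact fun h ↦ one_ne_zero (congrArg (fun f : ℂ →L[ℂ] ℂ ↦ f 1) h)
  · intro x _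
    simp [puncturedPlane]
  · have hball : Metric.ball (0 : ℂ) (Real.exp (-1)) ∈ 𝓝 (0 : ℂ) :=
      Metric.ball_mem_nhds _ (Real.exp_pos _)
    filter_upwards [hball] with x hx hxU
    have hx0 : x ≠ 0 := hxU
    have hnorm : ‖x‖ < Real.exp (-1) := by simpa using hx
    have hnorm1 : ‖x‖ < 1 := hnorm.trans_le (Real.exp_le_one_iff.2 (by norm_num))
    have hlog : Real.log ‖x‖ < -1 := by
      rw [Real.log_lt_iff_lt_exp (norm_pos_iff.2 hx0)]
      exact hnorm
    have hL : 1 ≤ Real.log ‖x‖ ^ 2 := by nlinarith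
    refine ⟨by simpa using hnorm1, ?_⟩
    change ∀ v : ℂ, _
    intro v
    have hmf : (mfderiv 𝓘(ℂ, ℂ) 𝓘(ℂ, ℂ) (OpenPartialHomeomorph.refl ℂ) x) v = v := by
      rw [OpenPartialHomeomorph.refl_apply, mfderiv_id]
      rfl
    have hq : poincareModelQuad (ContinuousLinearMap.id ℂ ℂ) (OpenPartialHomeomorph.refl ℂ x) v =
        ‖v‖ ^ 2 / (‖x‖ ^ 2 * Real.log ‖x‖ ^ 2) + ‖v‖ ^ 2 := rfl
    rw [hmf, metric_inner_self, hq]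
    exact two_sided_bound (‖x‖ ^ 2) (Real.log ‖x‖) _ (by positivity) hL (by positivity)

end PoincarePuncturedPlane

end Literature.Geometry.Kaehler
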